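import Mathlib
import Summits.ValiantsHypothesis.ValiantsHypothesis.Theorems.NewtonUnitEquationsTwoProductsPermutationTypeFamily
import HarnessLib

open scoped BigOperators
open MvPolynomial
open Summit.ValiantsHypothesis.ValiantsHypothesis.Theorems.NewtonUnitEquations.TwoProducts.FormalLogLinearisation
open Summit.ValiantsHypothesis.ValiantsHypothesis.Theorems.NewtonUnitEquations.TwoProducts.PlanarCell
open Summit.ValiantsHypothesis.ValiantsHypothesis.Theorems.NewtonUnitEquations.TwoProducts

namespace Summit.ValiantsHypothesis.ValiantsHypothesis.Cruxes.TwoProducts.RelationLadder.R6Sketch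

variable {m : ℕ}

/-- R6 hypothesis (typed target, NOT a rung): the multiset coincidences of the letter family form a RANK-ONE lattice generated by
one relation `ρ⁺ ~ ρ⁻` between two multisets of letters: `Σ a = Σ b` forces `mset a − mset b ∈ ℤ·(ρ⁺ − ρ⁻)`.
`ρ⁺ = ρ⁻ = 0` is `PermutationType.PermType A` (R3♯); identical supports with ONE planted relation `α+β = γ+δ` is
`ρ⁺ = {γ,δ}`, `ρ⁻ = {α,β}` — the located first residual instances of `ResidualLawV12`. -/
def RankOneCoincidences (A : Fin m → Finset Expo) (ρp ρm : Expo →₀ ℕ) : Prop :=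
  ∀ a ∈ tuples A, ∀ b ∈ tuples A, ∑ j, a j = ∑ j, b j →
    ∃ k : ℕ, PermutationType.msetT a + k • ρp = PermutationType.msetT b + k • ρm ∨
             PermutationType.msetT b + k • ρp = PermutationType.msetT a + k • ρm

/-- R6 as a law (CONJECTURE; no count engine known — see the card): global visible count under rank-one coincidences. -/
def RankOneLaw : Prop :=
  ∃ c : ℕ, ∀ (m : ℕ) (u v : Fin m → MvPolynomial (Fin 2) ℂ) (A : Fin m → Finset Expo),
    (∀ j, (0 : Expo) ∉ A j) → (∀ j, (u j).support ⊆ A j) → (∀ j, (v j).support ⊆ A j) →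
    (∃ ρp ρm : Expo →₀ ℕ, RankOneCoincidences A ρp ρm) →
    ∀ S : Finset Expo, (∀ l ∈ S, ∃ ξ : Fin 2 → ℝ, ValidWeight u v ξ ∧ IsStrictTop ξ ↑(tailDiff u v).support l) →
      S.card ≤ 2 ^ (c * m) * ((tailSupport u v).card + 2) ^ c

/-- Sanity: permutation type is the `ρ⁺ = ρ⁻ = 0` case. -/
theorem rankOne_of_permType (A : Fin m → Finset Expo) (h : PermutationType.PermType A) :
    RankOneCoincidences A 0 0 := by
  intro a ha b hb hab
  exact ⟨0, Or.inl (by simpa using h a ha b hb hab)⟩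

end Summit.ValiantsHypothesis.ValiantsHypothesis.Cruxes.TwoProducts.RelationLadder.R6Sketch
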